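import Literature.NumberTheory.LFunctions.SiegelZeroFormSumAsymptotic
import Literature.NumberTheory.QuadraticFields.DedekindZetaReducedForms
import Literature.NumberTheory.QuadraticFields.QuadraticDedekindZetaOddPrimitive
import Literature.NumberTheory.QuadraticFields.ImaginaryResiduePiForm
import Literature.Barriers.Parity.SiegelZeroDichotomy
import Mathlib.NumberTheory.LSeries.Nonvanishing
import Mathlib.Analysis.SpecialFunctions.Pow.Asymptotics
import HarnessLib

/-!
# Goldfeld–Schinzel 1975: the Corollary `1 − β ≥ (6/π − η)/√|d|` (`d < 0`) DERIVED from Theorem 1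
# — proofs for `SiegelZeroFormSumAsymptotic.lean`

Topic `Literature/NumberTheory/LFunctions` (namespace `Literature.NumberTheory.LFunctions`, auxiliary
objects in `GoldfeldSchinzel1975` as in the statement file). PROOF LAYER (theorems only, no new
definitions, no new named facts) for the statement file `SiegelZeroFormSumAsymptotic.lean`
(Goldfeld–Schinzel, Ann. Scuola Norm. Sup. Pisa (4) **2** (1975) 571–583 [GoldfeldSchinzel1975]),
typed by the cross-ladder literature-typing seat `littype-FP2-2` for the cell `parity-realchar`
(SIEGEL INSTRUMENT, conditionals column I.17) and cc `landau-siegel` (§C).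

## What is proved here

The statement file vendors Theorem 1 (`goldfeldSchinzel1975_theorem1`: for the real zero `β` in
the window `(1 − c₁/log|d|, 1)`,
`1 − β = (6/π²)(L(1,χ)/Σ' 1/a)[1 + O((log log|d|)²/log|d|) + O((1 − β) log|d|)]`) and, separately,
the Corollary (`goldfeldSchinzel1975_corollary`: `1 − β ≥ (6/π − η)/√|d|` for `d < 0`,
`(6/π² − η) log d/√d` for `d > 0`, `|d| > c(η)`) as NAMED FACTS. This file proves, in the kernel,
that **the `d < 0` half of the Corollary follows from Theorem 1** — exactly the printed deduction of
§4, p. 582: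

> "4. – PROOF OF COROLLARY. We can assume `1 − β < (log|d|)⁻²`. It then [follows] by Theorem (1)
> that for every `η > 0`, there exists `c(η)` such that if `d > c(η)`
> (19) `1 − β ≥ (6/π²)(L(1,χ)/Σ' 1/a)(1 − η/2)`.
> Let `h₀` be the number of classes of forms in question. For `d < −4`, we have
> `L(1,χ) = π h₀/√|d|`, and by Theorem (2) `Σ' 1/a ≤ h₀`. Hence by (19)
> `1 − β ≥ (6/π²)(h₀ π/(h₀ √|d|))(1 − η/2) > (6/π − η)(1/√|d|)`."

with the three inputs supplied by the tree:

* **`Σ' 1/a ≤ h₀`** (`GoldfeldSchinzel1975.formSum_neg_le_card_reducedForms`,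
  `GoldfeldSchinzel1975.formSum_neg_le_classNumber`): every form `(a, b, c)` of discriminant
  `d = −D` in the window `−a < b ≤ a < ¼√|d|` of Theorem 1 (2) has `4ac = b² + D > 16a²`, so
  `c > 4a` and the form is REDUCED (§3 p. 577: "we infer from (10) that [`c > a`] thus every form
  satisfying (10) is reduced") and primitive (`d` is fundamental —
  `GoldfeldSchinzel1975.isPrimitive_of_discr_isFundamental`); hence `(a, b) ↦ (a, b, c)` injects
  the window forms into the tree's `BinaryQuadraticForm.reducedForms (−D)` and
  `Σ' 1/a ≤ Σ' 1 ≤ #reducedForms(−D) = h(−D) = h_K` for the imaginary quadratic field `K` with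
  `d_K = −D`, by the tree's PROVED bridge `Quadratic.card_reducedForms_eq_classNumber`
  (Cox Thm. 7.7 (ii), `DedekindZetaReducedForms.lean`). (This is the content of Theorem 2 for
  `d < 0`, `Σ_{C} 1/|a| ≤ 1/m₀ ≤ 1` per class, summed over the `h₀` classes; the statement file
  also PROVES Theorem 2 (`d < 0`) as typed, `goldfeldSchinzel1975_theorem2_neg_holds`.)
* **`L(1,χ) = π h₀/√|d|`** for `d < −4` (`GoldfeldSchinzel1975.LFunction_one_re_eq`): the tree's
  class number formula `Quadratic.LFunction_one_eq_of_discr_neg_of_eq` (`2π h_K/(w_K √|d_K|)`)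
  with `w_K = 2` (`Quadratic.torsionOrder_eq_two_of_discr_lt_neg_four`), `ζ_K = ζ·L(·,χ)`
  (`Quadratic.dedekindZeta_eq_riemannZeta_mul_LFunction_of_odd_primitive`) and the existence of
  `K = ℚ(√−D)` (`Quadratic.exists_quadraticField_of_odd_primitive`).
* the bookkeeping of "we can assume `1 − β < (log|d|)⁻²`" and of the zeros outside the window of
  Theorem 1, absorbed into `c(η)`: every real zero has `β < 1`
  (Mathlib `DirichletCharacter.LFunction_ne_zero_of_one_le_re`), and `c₁/log D ≥ (6/π)/√D`,
  `(log D)⁻² ≥ (6/π)/√D`, `C·((log log D)²/log D + 1/log D) ≤ πη/6` for all large `D`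
  (`log D/√D → 0`, `(log D)²/√D → 0`, `(log log D)²/log D → 0` — Mathlib's
  `isLittleO_log_rpow_atTop`, `isLittleO_log_rpow_rpow_atTop`, `Real.tendsto_pow_log_div_mul_add_atTop`).
  The factor `(1 − η/2)` of (19) is taken as `(1 − πη/6)`, which gives the printed constant
  `6/π − η` on the nose.

Also, in Tao–Teräväinen's vocabulary (`Literature.Barriers.Parity.IsSiegelZero χ η`, quality `η`):
`GoldfeldSchinzel1975.IsSiegelZero.quality_le_of_theorem1_odd` — modulo Theorem 1, a Siegel zero of
an odd primitive quadratic `χ` mod `D > c(ε)` has quality `η ≤ √D/((6/π − ε) log D)`.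

And the OTHER direction of the same dictionary (appended): with the trivial `Σ' 1/a ≥ 1` (the
principal form lies in the window once `|d| > 16`, `GoldfeldSchinzel1975.one_le_formSum_neg`),
Theorem 1 bounds the window zero FROM ABOVE — `GoldfeldSchinzel1975.one_sub_le_classNumber_of_theorem1`:
modulo Theorem 1, for odd primitive quadratic `χ` mod `D > c(η)` and every real zero with
`1 − β < (log D)⁻²`, `1 − β ≤ (6/π + η)·h(−D)/√D` (`h(−D)` = number of reduced primitive forms,
`= h_K`: `one_sub_le_classNumber_field_of_theorem1`), via `mainTerm_le`
(`(6/π²)L(1,χ)/Σ' ≤ (6/π) h(−D)/√D`).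

Main theorem: `GoldfeldSchinzel1975.corollary_odd_of_theorem1 :
goldfeldSchinzel1975_theorem1 → ∀ η > 0, ∃ c, ∀ D > c, ∀ χ odd primitive quadratic mod D,
∀ β, L(β,χ) = 0 → (6/π − η)/√D ≤ 1 − β` — the odd (`d < 0`) conjunct of
`goldfeldSchinzel1975_corollary`, with the same binders. The even (`d > 0`) half needs Theorem 2 for
`d > 676` (continued fractions; the named fact `goldfeldSchinzel1975_theorem2_pos`) and the real
quadratic class number formula over proper classes of indefinite forms; it is not derived here.

LABEL (cell rule): proof layer; 0 new facts; nothing here asserts that a Siegel zero exists;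
nothing here bears on parity. No instances, no notation, no axioms beyond the standard three.

## References

* [GoldfeldSchinzel1975] D. M. Goldfeld, A. Schinzel, *On Siegel's zero*, Ann. Scuola Norm. Sup.
  Pisa Cl. Sci. (4) 2 (1975) 571–583: Theorem 1 (p. 571 (1)–(2)), Theorem 2 (pp. 571–572), §3
  (p. 577, window forms are reduced), Corollary (p. 572) and its proof §4 (p. 582, display (19)).
* [Cox2013] D. A. Cox, *Primes of the form x² + ny²*, 2nd ed., §2.A (2.7) reduced forms, Thm. 2.13,
  §7.B Thm. 7.7 (ii) (`h(d_K) = h_K`).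
* [MontgomeryVaughan2007] H. L. Montgomery, R. C. Vaughan, *Multiplicative Number Theory I*,
  Thm. 9.13 (primitive quadratic characters ↔ fundamental discriminants), §10.1 (class number
  formula).
-/

noncomputable section

open Finset Filter Topology
open scoped Classical

namespace Literature.NumberTheory.LFunctions

open Literature.NumberTheory.QuadraticFields
open Literature.NumberTheory.QuadraticFields.BinaryQuadraticForm (reducedForms mem_reducedForms_iff
  IsPrimitive IsReduced discr discr_apply discr_emod_four)
open GoldfeldSchinzel1975

namespace GoldfeldSchinzel1975

/-! ### Window forms are reduced and primitive; `Σ' 1/a ≤ h(d)` -/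

/-- **A form whose discriminant is a fundamental discriminant is primitive.** If `g = gcd(a, b, c)`
then `g² ∣ b² − 4ac = d`, so `g² ∈ {1, 4}` (`Quadratic.sq_eq_one_or_four_of_sq_dvd`); `g = 2` would
give `d = 4·disc(a/2, b/2, c/2)` with `d/4 ≡ 0, 1 (mod 4)`, against `d/4 ≡ 2, 3 (mod 4)` (and `4 ∤ d`
in the odd case). [cite: Cox2013, §2.A (forms of fundamental discriminant are primitive)]
[cite: MontgomeryVaughan2007, Theorem 9.13] -/
theorem isPrimitive_of_discr_isFundamental {d : ℤ}
    (hd : (d % 4 = 1 ∧ Squarefree d ∧ d ≠ 1) ∨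
      (4 ∣ d ∧ (d / 4 % 4 = 2 ∨ d / 4 % 4 = 3) ∧ Squarefree (d / 4)))
    {a b c : ℤ} (hdisc : discr (a, b, c) = d) : IsPrimitive (a, b, c) := by
  set g : ℕ := Int.gcd (Int.gcd a b) c with hg
  show Int.gcd (Int.gcd a b) c = 1
  rw [← hg]
  have hgab : (g : ℤ) ∣ (Int.gcd a b : ℤ) := Int.gcd_dvd_left ..
  have hga : (g : ℤ) ∣ a := hgab.trans (Int.gcd_dvd_left ..)
  have hgb : (g : ℤ) ∣ b := hgab.trans (Int.gcd_dvd_right ..)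
  have hgc : (g : ℤ) ∣ c := Int.gcd_dvd_right ..
  obtain ⟨a', ha'⟩ := hga
  obtain ⟨b', hb'⟩ := hgb
  obtain ⟨c', hc'⟩ := hgc
  have hdfac : d = (g : ℤ) ^ 2 * discr (a', b', c') := by
    rw [← hdisc, discr_apply, discr_apply, ha', hb', hc']
    ring
  have hsq : (g : ℤ) ^ 2 ∣ d := ⟨_, hdfac⟩
  have hg0 : (0 : ℤ) ≤ g := Nat.cast_nonneg g
  rcases Quadratic.sq_eq_one_or_four_of_sq_dvd hd hsq with h1 | h4
  · have : (g : ℤ) = 1 := by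
      have h' : ((g : ℤ) - 1) * ((g : ℤ) + 1) = 0 := by ring_nf; linarith
      rcases mul_eq_zero.mp h' with h | h
      · linarith
      · linarith
    exact_mod_cast this
  · exfalso
    have h2 : (g : ℤ) = 2 := by
      have h' : ((g : ℤ) - 2) * ((g : ℤ) + 2) = 0 := by ring_nf; linarith
      rcases mul_eq_zero.mp h' with h | h
      · linarith
      · linarith
    rw [h2] at hdfac
    have hm := discr_emod_four (a', b', c')
    generalize discr (a', b', c') = m at hdfac hm
    have hd4 : d / 4 = m := by rw [hdfac]; norm_num
    rcases hd with ⟨h1, -, -⟩ | ⟨-, h23, -⟩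
    · omega
    · omega

/-- **A window form is reduced** (Goldfeld–Schinzel §3, p. 577): if `a > 0`, `−a < b ≤ a`,
`16a² < D` and `4ac = b² + D`, then `c > 4a`, so `|b| ≤ a ≤ c` with `b ≥ 0` when `|b| = a`
(only `b = a` is possible) and `a ≠ c` — Cox's (2.7). [cite: GoldfeldSchinzel1975, §3 p. 577]
[cite: Cox2013, §2.A eq. (2.7)] -/
theorem isReduced_of_window {D a b c : ℤ} (ha : 0 < a) (hb1 : -a < b) (hb2 : b ≤ a)
    (hwin : 16 * a ^ 2 < D) (hc : 4 * a * c = b ^ 2 + D) : IsReduced (a, b, c) := by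
  have h4 : 4 * a < c := by nlinarith [sq_nonneg b]
  show -a ≤ b ∧ b ≤ a ∧ a ≤ c ∧ (b = -a ∨ b = a ∨ a = c → 0 ≤ b)
  refine ⟨by omega, hb2, by omega, fun h => by omega⟩

/-- **`Σ' 1/a ≤ h(d)` for `d = −D < 0` fundamental** (the inequality "by Theorem (2) `Σ' 1/a ≤ h₀`"
of the proof of the Corollary, §4 p. 582, with `h₀ = #reducedForms(−D)`): the window forms
`(a, b, (b² + D)/4a)`, `−a < b ≤ a`, `16a² < D`, are reduced and primitive, hence distinct members of
`BinaryQuadraticForm.reducedForms (−D)`, and each contributes `1/a ≤ 1`.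
[cite: GoldfeldSchinzel1975, §4 p. 582 (proof of the Corollary) with §3 p. 577]
[cite: Cox2013, §2.A Thm. 2.13] -/
theorem formSum_neg_le_card_reducedForms {D : ℕ}
    (hfund : ((-(D : ℤ)) % 4 = 1 ∧ Squarefree (-(D : ℤ)) ∧ (-(D : ℤ)) ≠ 1) ∨
      (4 ∣ (-(D : ℤ)) ∧ ((-(D : ℤ)) / 4 % 4 = 2 ∨ (-(D : ℤ)) / 4 % 4 = 3) ∧
        Squarefree ((-(D : ℤ)) / 4))) :
    formSum (-(D : ℤ)) ≤ ((reducedForms (-(D : ℤ))).card : ℝ) := by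
  have hD0 : 0 < D := by
    rcases Nat.eq_zero_or_pos D with h0 | hpos
    · exfalso
      subst h0
      rcases hfund with ⟨h1, -, -⟩ | ⟨-, h23, -⟩
      · norm_num at h1
      · norm_num at h23
    · exact hpos
  have hnat : (-(D : ℤ)).natAbs = D := by simp
  have hneg : (-(D : ℤ)) < 0 := by simp [hD0]
  unfold formSum
  rw [hnat]
  set A : Finset ℕ := (Icc 1 D).filter (fun a => 16 * a ^ 2 < D) with hA
  set B : ℕ → Finset ℤ :=
    fun a => (Ioc (-(a : ℤ)) (a : ℤ)).filter (fun b => (4 * (a : ℤ)) ∣ b ^ 2 - (-(D : ℤ))) with hB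
  have hpc : ∀ a : ℕ, pairCount (-(D : ℤ)) a = (B a).card := fun a => rfl
  -- the injection of window forms into reduced forms
  set f : (Σ _ : ℕ, ℤ) → ℤ × ℤ × ℤ :=
    fun p => ((p.1 : ℤ), p.2, (p.2 ^ 2 - (-(D : ℤ))) / (4 * (p.1 : ℤ))) with hf
  have hmaps : Set.MapsTo f (A.sigma B) (reducedForms (-(D : ℤ))) := by
    intro p hp
    rw [Finset.mem_coe, Finset.mem_sigma] at hp
    obtain ⟨hpA, hpB⟩ := hp
    simp only [hA, hB, Finset.mem_filter, Finset.mem_Icc, Finset.mem_Ioc] at hpA hpB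
    obtain ⟨⟨ha1, -⟩, hwin⟩ := hpA
    obtain ⟨⟨hb1, hb2⟩, hdvd⟩ := hpB
    have ha : (0 : ℤ) < (p.1 : ℤ) := by exact_mod_cast ha1
    have hwin' : 16 * (p.1 : ℤ) ^ 2 < (D : ℤ) := by exact_mod_cast hwin
    obtain ⟨c, hc⟩ := hdvd
    have hcdiv : (p.2 ^ 2 - (-(D : ℤ))) / (4 * (p.1 : ℤ)) = c := by
      rw [hc, Int.mul_ediv_cancel_left _ (by positivity)]
    have hc' : 4 * (p.1 : ℤ) * c = p.2 ^ 2 + D := by rw [← hc]; ring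
    have hfp : f p = ((p.1 : ℤ), p.2, c) := by simp only [hf, hcdiv]
    rw [Finset.mem_coe, hfp, mem_reducedForms_iff hneg]
    have hdisc : discr ((p.1 : ℤ), p.2, c) = -(D : ℤ) := by
      rw [discr_apply]
      linear_combination (-1 : ℤ) * hc'
    exact ⟨hdisc, ha, isPrimitive_of_discr_isFundamental hfund hdisc,
      isReduced_of_window ha hb1 hb2 hwin' hc'⟩
  have hinj : Set.InjOn f (A.sigma B) := by
    intro p _ q _ hpq
    simp only [hf, Prod.mk.injEq] at hpq
    obtain ⟨h1, h2, -⟩ := hpq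
    have h1' : p.1 = q.1 := by exact_mod_cast h1
    exact Sigma.ext h1' (heq_of_eq h2)
  have hcard : (A.sigma B).card ≤ (reducedForms (-(D : ℤ))).card :=
    Finset.card_le_card_of_injOn f hmaps hinj
  calc ∑ a ∈ A, (pairCount (-(D : ℤ)) a : ℝ) / (a : ℝ)
      ≤ ∑ a ∈ A, (pairCount (-(D : ℤ)) a : ℝ) := by
        refine Finset.sum_le_sum fun a ha => ?_
        simp only [hA, Finset.mem_filter, Finset.mem_Icc] at ha
        exact div_le_self (Nat.cast_nonneg _) (by exact_mod_cast ha.1.1)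
    _ = ((A.sigma B).card : ℝ) := by
        rw [Finset.card_sigma]
        push_cast
        simp only [hpc]
    _ ≤ ((reducedForms (-(D : ℤ))).card : ℝ) := by exact_mod_cast hcard

/-- **`Σ' 1/a ≤ h_K`** for the imaginary quadratic field `K` with `d_K = −D`: `Σ' 1/a ≤ h(−D)`
(`formSum_neg_le_card_reducedForms`, `d_K` is fundamental by
`Quadratic.isFundamentalDiscriminant_discr`) and `h(d_K) = h_K` (the tree's PROVED Cox Thm. 7.7 (ii),
`Quadratic.card_reducedForms_eq_classNumber`). [cite: GoldfeldSchinzel1975, §4 p. 582]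
[cite: Cox2013, §7.B Thm. 7.7 (ii)] -/
theorem formSum_neg_le_classNumber {D : ℕ} (K : Type*) [Field K] [NumberField K]
    (h2 : Module.finrank ℚ K = 2) (hdK : NumberField.discr K = -(D : ℤ)) :
    formSum (-(D : ℤ)) ≤ (NumberField.classNumber K : ℝ) := by
  have hd : NumberField.discr K < 0 := by
    have hne : NumberField.discr K ≠ 0 := NumberField.discr_ne_zero K
    rw [hdK] at hne ⊢
    omega
  have hfund := Quadratic.isFundamentalDiscriminant_discr (K := K) h2
  rw [hdK] at hfund
  have hcard := Quadratic.card_reducedForms_eq_classNumber (K := K) h2 hd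
  rw [hdK] at hcard
  calc formSum (-(D : ℤ)) ≤ ((reducedForms (-(D : ℤ))).card : ℝ) :=
        formSum_neg_le_card_reducedForms hfund
    _ = (NumberField.classNumber K : ℝ) := by
        rw [← hcard]
        rfl

/-! ### `L(1, χ) = π h_K/√D` for odd primitive quadratic `χ` mod `D > 4` -/

/-- **Dirichlet's class number formula, as used on p. 582: `L(1, χ) = π h₀/√|d|` for `d < −4`.**
For an odd primitive quadratic `χ` mod `D > 4` and the imaginary quadratic field `K` with
`d_K = −D`: `Re L(1, χ) = π h_K/√D` (tree: `Quadratic.LFunction_one_eq_of_discr_neg_of_eq`, `w_K = 2`).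
[cite: GoldfeldSchinzel1975, §4 p. 582] [cite: MontgomeryVaughan2007, §10.1] -/
theorem LFunction_one_re_eq {D : ℕ} [NeZero D] {χ : DirichletCharacter ℂ D}
    (hprim : χ.IsPrimitive) (hquad : χ.IsQuadratic) (hodd : χ.Odd) (hD : 4 < D)
    (K : Type*) [Field K] [NumberField K] (h2 : Module.finrank ℚ K = 2)
    (hdK : NumberField.discr K = -(D : ℤ)) :
    (χ.LFunction 1).re = Real.pi * NumberField.classNumber K / Real.sqrt D := by
  have hD0 : 0 < D := Nat.pos_of_ne_zero (NeZero.ne D)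
  have hd : NumberField.discr K < 0 := by rw [hdK, neg_lt_zero]; exact_mod_cast hD0
  have hd4 : NumberField.discr K < -4 := by rw [hdK]; omega
  have hχ1 : χ ≠ 1 := by
    intro h1
    have hm : χ (-1) = -1 := hodd
    rw [h1, MulChar.one_apply isUnit_one.neg] at hm
    norm_num at hm
  have hζ : ∀ s : ℝ, 1 < s →
      NumberField.dedekindZeta K s = riemannZeta s * LSeries (fun n => χ n) s := by
    intro s hs
    have hs' : 1 < (s : ℂ).re := by simpa using hs
    rw [← DirichletCharacter.LFunction_eq_LSeries χ hs']
    exact Quadratic.dedekindZeta_eq_riemannZeta_mul_LFunction_of_odd_primitive hprim hquad hodd h2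
      hdK hs'
  have hL := Quadratic.LFunction_one_eq_of_discr_neg_of_eq h2 hd hχ1 hζ
  have habs : |(NumberField.discr K : ℝ)| = (D : ℝ) := by
    rw [hdK]; push_cast; rw [abs_neg]; exact abs_of_nonneg (Nat.cast_nonneg D)
  have hw : (NumberField.Units.torsionOrder K : ℝ) = 2 := by
    exact_mod_cast Quadratic.torsionOrder_eq_two_of_discr_lt_neg_four h2 hd4
  rw [habs, hw] at hL
  rw [hL, Complex.ofReal_re]
  ring

/-- **`Re L(1, χ) > 0`** for an odd primitive quadratic `χ` mod `D > 4` (`= π h_K/√D`, `h_K ≥ 1`).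
[cite: GoldfeldSchinzel1975, §4 p. 582] -/
theorem LFunction_one_re_pos {D : ℕ} [NeZero D] {χ : DirichletCharacter ℂ D}
    (hprim : χ.IsPrimitive) (hquad : χ.IsQuadratic) (hodd : χ.Odd) (hD : 4 < D) :
    0 < (χ.LFunction 1).re := by
  obtain ⟨K, _, _, h2, hdK⟩ := Quadratic.exists_quadraticField_of_odd_primitive hprim hquad hodd
  rw [LFunction_one_re_eq hprim hquad hodd hD K h2 hdK]
  have hD0 : (0 : ℝ) < D := by exact_mod_cast (lt_trans (by norm_num) hD : 0 < D)
  have hh : (0 : ℝ) < NumberField.classNumber K := by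
    exact_mod_cast NumberField.classNumber_pos (K := K)
  have hsqrt : 0 < Real.sqrt D := Real.sqrt_pos.mpr hD0
  positivity

/-- **The main term of Theorem 1 is at least `(6/π)/√D` when `d < −4`:**
`(6/π²)·L(1,χ)/Σ' 1/a ≥ (6/π²)·(π h₀/√|d|)/h₀ = (6/π)/√|d|` (p. 582), provided `Σ' 1/a ≠ 0`.
[cite: GoldfeldSchinzel1975, §4 p. 582 (last display)] -/
theorem mainTerm_ge {D : ℕ} [NeZero D] {χ : DirichletCharacter ℂ D}
    (hprim : χ.IsPrimitive) (hquad : χ.IsQuadratic) (hodd : χ.Odd) (hD : 4 < D)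
    (hF : formSum (-(D : ℤ)) ≠ 0) :
    6 / Real.pi / Real.sqrt D ≤ 6 / Real.pi ^ 2 * (χ.LFunction 1).re / formSum (-(D : ℤ)) := by
  obtain ⟨K, _, _, h2, hdK⟩ := Quadratic.exists_quadraticField_of_odd_primitive hprim hquad hodd
  have hre := LFunction_one_re_eq hprim hquad hodd hD K h2 hdK
  have hFle := formSum_neg_le_classNumber K h2 hdK
  have hF0 : 0 < formSum (-(D : ℤ)) := lt_of_le_of_ne (formSum_nonneg _) (Ne.symm hF)
  have hD0 : (0 : ℝ) < D := by exact_mod_cast (lt_trans (by norm_num) hD : 0 < D)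
  have hh : (0 : ℝ) < NumberField.classNumber K := by
    exact_mod_cast NumberField.classNumber_pos (K := K)
  have hsqrt : 0 < Real.sqrt D := Real.sqrt_pos.mpr hD0
  have hπ := Real.pi_pos
  -- `L(1)/Σ' ≥ L(1)/h = π/√D`
  have hstep : Real.pi / Real.sqrt D ≤ (χ.LFunction 1).re / formSum (-(D : ℤ)) := by
    have hL0 : 0 ≤ (χ.LFunction 1).re := by rw [hre]; positivity
    calc Real.pi / Real.sqrt D
        = (χ.LFunction 1).re / (NumberField.classNumber K : ℝ) := by
          rw [hre]; field_simp
      _ ≤ (χ.LFunction 1).re / formSum (-(D : ℤ)) := div_le_div_of_nonneg_left hL0 hF0 hFle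
  calc 6 / Real.pi / Real.sqrt D = 6 / Real.pi ^ 2 * (Real.pi / Real.sqrt D) := by
        field_simp
    _ ≤ 6 / Real.pi ^ 2 * ((χ.LFunction 1).re / formSum (-(D : ℤ))) := by gcongr
    _ = 6 / Real.pi ^ 2 * (χ.LFunction 1).re / formSum (-(D : ℤ)) := by ring

/-! ### Real zeros are `< 1`; the three "large `D`" thresholds -/

/-- Every real zero of `L(s, χ)`, `χ ≠ 1`, has `β < 1` (non-vanishing on `Re s ≥ 1`, Mathlib).
[folklore] -/
private theorem lt_one_of_LFunction_eq_zero {D : ℕ} [NeZero D] {χ : DirichletCharacter ℂ D} (hχ : χ ≠ 1)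
    {β : ℝ} (hβ : χ.LFunction (β : ℂ) = 0) : β < 1 := by
  by_contra hle
  exact DirichletCharacter.LFunction_ne_zero_of_one_le_re χ (Or.inl hχ)
    (by simpa using not_lt.mp hle) hβ

/-- From a real limit `f(x) → 0` (`x → ∞`) to a natural threshold: `f(n) < ε` for all `n ≥ N`.
[folklore] -/
private theorem exists_nat_forall_lt_of_tendsto {f : ℝ → ℝ} (hf : Tendsto f atTop (𝓝 0)) {ε : ℝ}
    (hε : 0 < ε) : ∃ N : ℕ, ∀ n : ℕ, N ≤ n → f n < ε := by
  have h := (hf.comp tendsto_natCast_atTop_atTop).eventually (eventually_lt_nhds hε)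
  obtain ⟨N, hN⟩ := Filter.eventually_atTop.mp h
  exact ⟨N, fun n hn => hN n hn⟩

/-- `log x/√x → 0`. [folklore] -/
private theorem tendsto_log_div_sqrt : Tendsto (fun x : ℝ => Real.log x / Real.sqrt x) atTop (𝓝 0) := by
  have h := (isLittleO_log_rpow_atTop (by norm_num : (0 : ℝ) < 1 / 2)).tendsto_div_nhds_zero
  refine h.congr' (Eventually.of_forall fun x => ?_)
  simp only [Real.sqrt_eq_rpow]

/-- `(log x)²/√x → 0`. [folklore] -/
private theorem tendsto_log_sq_div_sqrt :
    Tendsto (fun x : ℝ => Real.log x ^ 2 / Real.sqrt x) atTop (𝓝 0) := by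
  have h := (isLittleO_log_rpow_rpow_atTop (2 : ℝ) (by norm_num : (0 : ℝ) < 1 / 2)).tendsto_div_nhds_zero
  refine h.congr' (Eventually.of_forall fun x => ?_)
  simp only [Real.sqrt_eq_rpow, Real.rpow_two]

/-- `(log log x)²/log x + 1/log x → 0`. [folklore] -/
private theorem tendsto_loglog_sq_div_log_add_inv_log :
    Tendsto (fun x : ℝ => Real.log (Real.log x) ^ 2 / Real.log x + (Real.log x)⁻¹) atTop (𝓝 0) := by
  have h1 := (Real.tendsto_pow_log_div_mul_add_atTop 1 0 2 one_ne_zero).comp Real.tendsto_log_atTop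
  have h2 := tendsto_inv_atTop_zero.comp Real.tendsto_log_atTop
  have h := h1.add h2
  rw [add_zero] at h
  refine h.congr' (Eventually.of_forall fun x => ?_)
  simp

/-! ### The Corollary for `d < 0`, from Theorem 1 -/

/-- **Goldfeld–Schinzel 1975, Corollary, case `d < 0`, DERIVED from Theorem 1** (§4 p. 582): modulo
the named fact `goldfeldSchinzel1975_theorem1`, for every `η > 0` there is an (effective, given the
constants of Theorem 1) `c(η)` such that for every odd primitive quadratic `χ` mod `D > c(η)` (so
`d = −D` is a fundamental discriminant) and EVERY real zero `β` of `L(s, χ)`,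
`1 − β ≥ (6/π − η)/√D`. This is the odd conjunct of `goldfeldSchinzel1975_corollary`, with the same
binders. Proof as printed: for the zero in the window of Theorem 1 with `1 − β < (log D)⁻²`,
`1 − β ≥ M(1 − C((log log D)²/log D + 1/log D)) ≥ M(1 − πη/6)` with
`M = (6/π²)L(1,χ)/Σ' 1/a ≥ (6/π)/√D` (`mainTerm_ge`: `L(1,χ) = π h/√D`, `Σ' 1/a ≤ h`); the zeros
with `β ≤ 1 − c₁/log D` or `1 − β ≥ (log D)⁻²` satisfy the bound trivially once
`c₁/log D, (log D)⁻² ≥ (6/π)/√D`, i.e. for `D` beyond an effective threshold absorbed into `c(η)`.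
[cite: GoldfeldSchinzel1975, Corollary p. 572 (case d < 0), proof §4 p. 582] -/
theorem corollary_odd_of_theorem1 (h : goldfeldSchinzel1975_theorem1) {η : ℝ} (hη : 0 < η) :
    ∃ c : ℕ, ∀ (D : ℕ) [NeZero D], c < D →
      ∀ χ : DirichletCharacter ℂ D, χ.IsQuadratic → χ.IsPrimitive → χ.Odd →
        ∀ β : ℝ, χ.LFunction (β : ℂ) = 0 → (6 / Real.pi - η) / Real.sqrt D ≤ 1 - β := by
  obtain ⟨c₁, hc₁, C, D₀, hT⟩ := h
  have hπ := Real.pi_pos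
  set C' : ℝ := max C 0 with hC'
  have hC'0 : 0 ≤ C' := le_max_right _ _
  have hCC' : C ≤ C' := le_max_left _ _
  -- the three thresholds
  obtain ⟨N₁, hN₁⟩ := exists_nat_forall_lt_of_tendsto tendsto_log_div_sqrt
    (by positivity : 0 < c₁ * Real.pi / 6)
  obtain ⟨N₂, hN₂⟩ := exists_nat_forall_lt_of_tendsto tendsto_log_sq_div_sqrt
    (by positivity : 0 < Real.pi / 6)
  obtain ⟨N₃, hN₃⟩ := exists_nat_forall_lt_of_tendsto
    (by simpa using tendsto_loglog_sq_div_log_add_inv_log.const_mul C')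
    (by positivity : 0 < Real.pi * η / 6)
  refine ⟨max (max (max D₀ 4) N₁) (max N₂ N₃), fun D _ hcD χ hquad hprim hodd β hβ => ?_⟩
  simp only [max_lt_iff] at hcD
  obtain ⟨⟨⟨hD₀, hD4⟩, hD₁⟩, hD₂, hD₃⟩ := hcD
  have hD0 : (0 : ℝ) < D := by exact_mod_cast (lt_trans (by norm_num) hD4 : 0 < D)
  have hD1 : (1 : ℝ) < D := by exact_mod_cast (lt_trans (by norm_num) hD4 : 1 < D)
  have hsqrt : 0 < Real.sqrt D := Real.sqrt_pos.mpr hD0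
  have hlog : 0 < Real.log D := Real.log_pos hD1
  -- `β < 1`
  have hχ1 : χ ≠ 1 := by
    intro h1
    have hm : χ (-1) = -1 := hodd
    rw [h1, MulChar.one_apply isUnit_one.neg] at hm
    norm_num at hm
  have hβ1 : β < 1 := lt_one_of_LFunction_eq_zero hχ1 hβ
  -- trivial when `η ≥ 6/π`
  by_cases hη' : 6 / Real.pi ≤ η
  · calc (6 / Real.pi - η) / Real.sqrt D ≤ 0 :=
          div_nonpos_of_nonpos_of_nonneg (by linarith) hsqrt.le
      _ ≤ 1 - β := by linarith
  replace hη' : η < 6 / Real.pi := not_le.mp hη'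
  -- (E1) `(6/π)/√D ≤ c₁/log D`, (E2) `(6/π)/√D ≤ (log D)⁻²`
  have hE1 : 6 / Real.pi / Real.sqrt D ≤ c₁ / Real.log D := by
    have h1 := (hN₁ D hD₁.le).le
    rw [div_le_iff₀ hsqrt] at h1
    rw [div_div, div_le_div_iff₀ (by positivity) hlog]
    nlinarith
  have hE2 : 6 / Real.pi / Real.sqrt D ≤ 1 / Real.log D ^ 2 := by
    have h2 := (hN₂ D hD₂.le).le
    rw [div_le_iff₀ hsqrt] at h2
    rw [div_div, div_le_div_iff₀ (by positivity) (by positivity)]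
    nlinarith
  have hE3 : C' * (Real.log (Real.log D) ^ 2 / Real.log D + (Real.log D)⁻¹) ≤ Real.pi * η / 6 :=
    (hN₃ D hD₃.le).le
  have hbase : (6 / Real.pi - η) / Real.sqrt D ≤ 6 / Real.pi / Real.sqrt D := by
    gcongr; linarith
  -- zeros outside the window of Theorem 1
  by_cases hwin : β ≤ 1 - c₁ / Real.log D
  · calc (6 / Real.pi - η) / Real.sqrt D ≤ 6 / Real.pi / Real.sqrt D := hbase
      _ ≤ c₁ / Real.log D := hE1
      _ ≤ 1 - β := by linarith
  replace hwin : 1 - c₁ / Real.log D < β := not_le.mp hwin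
  -- "we can assume `1 − β < (log D)⁻²`"
  by_cases hsmall : 1 / Real.log D ^ 2 ≤ 1 - β
  · exact (hbase.trans hE2).trans hsmall
  replace hsmall : 1 - β < 1 / Real.log D ^ 2 := not_le.mp hsmall
  -- Theorem 1 for this zero
  have key := hT D hD₀.le χ hquad hprim β hwin hβ1 hβ
  rw [signedDisc_of_odd hodd] at key
  set M : ℝ := 6 / Real.pi ^ 2 * (χ.LFunction 1).re / formSum (-(D : ℤ)) with hM
  set ℓ : ℝ := Real.log (Real.log D) ^ 2 / Real.log D with hℓ
  have hℓ0 : 0 ≤ ℓ := by positivity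
  have hlow : M - M * C * (ℓ + (1 - β) * Real.log D) ≤ 1 - β := by
    have := (abs_le.mp key).1
    linarith
  by_cases hF : formSum (-(D : ℤ)) = 0
  · -- `Σ' = 0`: then `M = 0` and Theorem 1 forces `β = 1`, impossible
    exfalso
    have hM0 : M = 0 := by rw [hM, hF, div_zero]
    rw [hM0] at key
    have h0 : |(1 - β) - 0| ≤ 0 := by simpa using key
    have : 1 - β = 0 := by
      have := abs_nonpos_iff.mp h0
      linarith
    linarith
  have hMge : 6 / Real.pi / Real.sqrt D ≤ M := mainTerm_ge hprim hquad hodd hD4 hF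
  have hM0 : 0 ≤ M := le_trans (by positivity) hMge
  -- `(1 − β) log D ≤ 1/log D`
  have hprod : (1 - β) * Real.log D ≤ (Real.log D)⁻¹ := by
    have : (1 - β) * Real.log D < 1 / Real.log D ^ 2 * Real.log D :=
      mul_lt_mul_of_pos_right hsmall hlog
    rw [show 1 / Real.log D ^ 2 * Real.log D = (Real.log D)⁻¹ by field_simp] at this
    exact this.le
  -- `M·C·(ℓ + (1−β) log D) ≤ M·(πη/6)`
  have herr : M * C * (ℓ + (1 - β) * Real.log D) ≤ M * (Real.pi * η / 6) := by
    have hnn : 0 ≤ ℓ + (1 - β) * Real.log D := by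
      have : 0 ≤ (1 - β) * Real.log D := mul_nonneg (by linarith) hlog.le
      linarith
    calc M * C * (ℓ + (1 - β) * Real.log D) ≤ M * C' * (ℓ + (1 - β) * Real.log D) := by
          gcongr
      _ = M * (C' * (ℓ + (1 - β) * Real.log D)) := by ring
      _ ≤ M * (C' * (ℓ + (Real.log D)⁻¹)) := by gcongr
      _ ≤ M * (Real.pi * η / 6) := by gcongr
  have hfac : 0 ≤ 1 - Real.pi * η / 6 := by
    have : Real.pi * η < 6 := by
      have := (lt_div_iff₀ hπ).mp hη'
      linarith
    linarith
  calc (6 / Real.pi - η) / Real.sqrt D = 6 / Real.pi / Real.sqrt D * (1 - Real.pi * η / 6) := by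
        field_simp
    _ ≤ M * (1 - Real.pi * η / 6) := by gcongr
    _ = M - M * (Real.pi * η / 6) := by ring
    _ ≤ M - M * C * (ℓ + (1 - β) * Real.log D) := by linarith
    _ ≤ 1 - β := hlow

/-- **The Corollary (`d < 0`) in Tao–Teräväinen's vocabulary, from Theorem 1**: modulo
`goldfeldSchinzel1975_theorem1`, for `ε > 0` with `6/π − ε > 0` there is `c` such that for every
`D > c` and every ODD character `χ` mod `D`, a Siegel zero `β = 1 − 1/(η log D)` of quality `η` of `χ`
(Tao–Teräväinen's Definition 1.4: `χ` primitive quadratic, `η ≥ 10`, `L(β, χ) = 0` — the column's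
`Literature.Barriers.Parity.IsSiegelZero χ η`) has **`η ≤ √D/((6/π − ε) log D)`** — to be compared
with Pintz's `√D/((12/π − ε) log D)` (`Pintz1976.IsSiegelZero.quality_le_of_theorem3`, modulo
`pintz1976_theorem3`). [cite: GoldfeldSchinzel1975, Corollary p. 572 (case d < 0), §4 p. 582]
[cite: TaoTeravainen2021, Definition 1.4] -/
theorem IsSiegelZero.quality_le_of_theorem1_odd (h : goldfeldSchinzel1975_theorem1) {ε : ℝ}
    (hε : 0 < ε) (hε' : 0 < 6 / Real.pi - ε) :
    ∃ c : ℕ, ∀ (D : ℕ) [NeZero D], c < D → ∀ (χ : DirichletCharacter ℂ D) (η : ℝ), χ.Odd →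
      Literature.Barriers.Parity.IsSiegelZero χ η →
        η ≤ Real.sqrt D / ((6 / Real.pi - ε) * Real.log D) := by
  obtain ⟨c, hc⟩ := corollary_odd_of_theorem1 h hε
  refine ⟨max c 2, fun D _ hD χ η hodd hS => ?_⟩
  obtain ⟨hcD, h2D⟩ := max_lt_iff.mp hD
  obtain ⟨hprim, hquad, h10, hz⟩ := hS
  have hD1 : (1 : ℝ) < D := by exact_mod_cast (lt_trans one_lt_two h2D)
  have hlog : 0 < Real.log D := Real.log_pos hD1
  have hη : 0 < η := by linarith
  have hηlog : 0 < η * Real.log D := by positivity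
  have hb := hc D hcD χ hquad hprim hodd _ hz
  have hsqrt : 0 < Real.sqrt D := Real.sqrt_pos.mpr (by positivity)
  have hb' : (6 / Real.pi - ε) / Real.sqrt D ≤ 1 / (η * Real.log D) := by
    have hid : (1 : ℝ) - (1 - 1 / (η * Real.log D)) = 1 / (η * Real.log D) := by ring
    linarith
  rw [div_le_div_iff₀ hsqrt hηlog] at hb'
  rw [le_div_iff₀ (by positivity)]
  nlinarith

/-! ### The other direction of the dictionary: `Σ' 1/a ≥ 1`, hence `1 − β ≤ (6/π + η)·h(−D)/√D`

Theorem 1 is a two-sided asymptotic. With the trivial LOWER bound `Σ' 1/a ≥ 1` (the principal form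
`(1, b₀, c)`, `b₀ ∈ {0, 1}`, lies in the window as soon as `|d| > 16`) it gives, for the zero of the
window with `1 − β < (log|d|)⁻²`, the UPPER bound `1 − β ≤ (6/π²)(1 + η′)L(1,χ) = (6/π + η) h(d)/√|d|`
— the «small class number ⇒ the zero is close to `1`» direction of the same dictionary (the constant
`6/π` of Theorem 1's main term; effective thresholds). This is an immediate reading of Theorem 1
(p. 571 (1)–(2)) with `L(1,χ) = π h/√|d|` (p. 582), recorded for the column's topic I.1/I.17. -/

/-- **`Σ' 1/a ≥ 1` for `d = −D`, `D > 16`, `−D ≡ 0, 1 (mod 4)`**: the principal form `(1, b₀, (b₀² + D)/4)`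
with `b₀ = 0` (`4 ∣ D`) or `b₀ = 1` (`D ≡ 3 (mod 4)`) has `−1 < b₀ ≤ 1 = a` and `16a² = 16 < D`, so it
is counted in `Σ'` with weight `1/a = 1`. [cite: GoldfeldSchinzel1975, Theorem 1 (2) p. 571]
[cite: Cox2013, §2.C (principal form)] -/
theorem one_le_formSum_neg {D : ℕ} (hD : 16 < D) (h4 : 4 ∣ (D : ℤ) ∨ (D : ℤ) % 4 = 3) :
    1 ≤ formSum (-(D : ℤ)) := by
  have hnat : (-(D : ℤ)).natAbs = D := by simp
  unfold formSum
  rw [hnat]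
  have h1mem : (1 : ℕ) ∈ (Icc 1 D).filter (fun a : ℕ => 16 * a ^ 2 < D) := by
    simp only [Finset.mem_filter, Finset.mem_Icc]
    refine ⟨⟨le_rfl, by omega⟩, by simpa using hD⟩
  have hterm : (1 : ℝ) ≤ (pairCount (-(D : ℤ)) 1 : ℝ) / ((1 : ℕ) : ℝ) := by
    rw [Nat.cast_one, div_one, Nat.one_le_cast]
    -- a witness `b₀ ∈ (−1, 1]` with `4 ∣ b₀² + D`
    unfold pairCount
    apply Finset.card_pos.mpr
    rcases h4 with h0 | h3
    · refine ⟨0, ?_⟩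
      simp only [Finset.mem_filter, Finset.mem_Ioc, Nat.cast_one]
      refine ⟨⟨by norm_num, by norm_num⟩, ?_⟩
      simpa using h0
    · refine ⟨1, ?_⟩
      simp only [Finset.mem_filter, Finset.mem_Ioc, Nat.cast_one]
      refine ⟨⟨by norm_num, by norm_num⟩, ?_⟩
      have : (4 : ℤ) ∣ (D : ℤ) + 1 := by omega
      simpa [sub_neg_eq_add, add_comm] using this
  refine hterm.trans ?_
  exact Finset.single_le_sum (f := fun a : ℕ => (pairCount (-(D : ℤ)) a : ℝ) / (a : ℝ))
    (fun a _ => by positivity) h1mem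

/-- **The main term of Theorem 1 is at most `(6/π)·h(−D)/√D` when `D > 16`:**
`(6/π²)·L(1,χ)/Σ' 1/a ≤ (6/π²)·L(1,χ) = (6/π²)·π h(−D)/√D` by `Σ' 1/a ≥ 1` (`one_le_formSum_neg`) and the
class number formula (`LFunction_one_re_eq`, `Quadratic.card_reducedForms_eq_classNumber`), with
`h(−D) = BinaryQuadraticForm.classNumber (−D)` the number of reduced primitive forms.
[cite: GoldfeldSchinzel1975, Theorem 1 p. 571 with §4 p. 582] [cite: Cox2013, §7.B Thm. 7.7 (ii)] -/
theorem mainTerm_le {D : ℕ} [NeZero D] {χ : DirichletCharacter ℂ D}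
    (hprim : χ.IsPrimitive) (hquad : χ.IsQuadratic) (hodd : χ.Odd) (hD : 16 < D) :
    6 / Real.pi ^ 2 * (χ.LFunction 1).re / formSum (-(D : ℤ)) ≤
      6 / Real.pi * (BinaryQuadraticForm.classNumber (-(D : ℤ)) : ℝ) / Real.sqrt D := by
  obtain ⟨K, _, _, h2, hdK⟩ := Quadratic.exists_quadraticField_of_odd_primitive hprim hquad hodd
  have hD4 : 4 < D := lt_trans (by norm_num) hD
  have hre := LFunction_one_re_eq hprim hquad hodd hD4 K h2 hdK
  have hd : NumberField.discr K < 0 := by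
    have hD0 : 0 < D := lt_trans (by norm_num) hD
    rw [hdK, neg_lt_zero]; exact_mod_cast hD0
  have hcard := Quadratic.card_reducedForms_eq_classNumber (K := K) h2 hd
  rw [hdK] at hcard
  -- `−D ≡ 0, 1 (mod 4)`
  have hfund := Quadratic.isFundamentalDiscriminant_discr (K := K) h2
  rw [hdK] at hfund
  have h4 : 4 ∣ (D : ℤ) ∨ (D : ℤ) % 4 = 3 := by
    rcases hfund with ⟨h1, -, -⟩ | ⟨h0, -, -⟩
    · right; omega
    · left; exact (dvd_neg).mp h0
  have hF1 := one_le_formSum_neg hD h4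
  have hπ := Real.pi_pos
  have hL0 : 0 ≤ (χ.LFunction 1).re := by rw [hre]; positivity
  have hstep : (χ.LFunction 1).re / formSum (-(D : ℤ)) ≤ (χ.LFunction 1).re :=
    div_le_self hL0 hF1
  calc 6 / Real.pi ^ 2 * (χ.LFunction 1).re / formSum (-(D : ℤ))
      = 6 / Real.pi ^ 2 * ((χ.LFunction 1).re / formSum (-(D : ℤ))) := by ring
    _ ≤ 6 / Real.pi ^ 2 * (χ.LFunction 1).re := by gcongr
    _ = 6 / Real.pi * (NumberField.classNumber K : ℝ) / Real.sqrt D := by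
        rw [hre]; field_simp
    _ = 6 / Real.pi * (BinaryQuadraticForm.classNumber (-(D : ℤ)) : ℝ) / Real.sqrt D := by
        rw [hcard]

/-- **Goldfeld–Schinzel 1975, Theorem 1 read as an UPPER bound for the Siegel zero's distance from
`1` in terms of the class number (modulo the named fact `goldfeldSchinzel1975_theorem1`):** for every
`η > 0` there is an effective `c` such that for every odd primitive quadratic `χ` mod `D > c` and
every real zero `β` of `L(s, χ)` with `1 − β < (log D)⁻²`,
**`1 − β ≤ (6/π + η) · h(−D)/√D`**, `h(−D)` the number of reduced primitive forms of discriminant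
`−D` (`= h_K`, Cox Thm. 7.7 (ii)). From Theorem 1: `1 − β ≤ M(1 + C((log log D)²/log D + 1/log D))
≤ M(1 + πη/6)` and `M = (6/π²)L(1,χ)/Σ' 1/a ≤ (6/π) h(−D)/√D` (`mainTerm_le`); the window condition
`1 − c₁/log D < β` of Theorem 1 follows from `1 − β < (log D)⁻² ≤ c₁/log D` once `log D ≥ 1/c₁`.
The «small class number ⇒ `β` close to `1`» direction of topic I.1 with the constant `6/π` of the
main term; nothing here asserts that such a zero exists.
[cite: GoldfeldSchinzel1975, Theorem 1 p. 571 (1)–(2) with §4 p. 582 (L(1,χ) = πh₀/√|d|)] -/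
theorem one_sub_le_classNumber_of_theorem1 (h : goldfeldSchinzel1975_theorem1) {η : ℝ}
    (hη : 0 < η) :
    ∃ c : ℕ, ∀ (D : ℕ) [NeZero D], c < D →
      ∀ χ : DirichletCharacter ℂ D, χ.IsQuadratic → χ.IsPrimitive → χ.Odd →
        ∀ β : ℝ, χ.LFunction (β : ℂ) = 0 → 1 - β < 1 / Real.log D ^ 2 →
          1 - β ≤ (6 / Real.pi + η) * (BinaryQuadraticForm.classNumber (-(D : ℤ)) : ℝ) /
            Real.sqrt D := by
  obtain ⟨c₁, hc₁, C, D₀, hT⟩ := h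
  have hπ := Real.pi_pos
  set C' : ℝ := max C 0 with hC'
  have hC'0 : 0 ≤ C' := le_max_right _ _
  have hCC' : C ≤ C' := le_max_left _ _
  -- thresholds: `1/log D ≤ c₁` and `C'·((log log D)²/log D + 1/log D) ≤ πη/6`
  obtain ⟨N₁, hN₁⟩ := exists_nat_forall_lt_of_tendsto
    (tendsto_inv_atTop_zero.comp Real.tendsto_log_atTop) hc₁
  obtain ⟨N₃, hN₃⟩ := exists_nat_forall_lt_of_tendsto
    (by simpa using tendsto_loglog_sq_div_log_add_inv_log.const_mul C')
    (by positivity : 0 < Real.pi * η / 6)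
  refine ⟨max (max D₀ 16) (max N₁ N₃), fun D _ hcD χ hquad hprim hodd β hβ hsmall => ?_⟩
  simp only [max_lt_iff] at hcD
  obtain ⟨⟨hD₀, hD16⟩, hD₁, hD₃⟩ := hcD
  have hD1 : (1 : ℝ) < D := by exact_mod_cast (lt_trans (by norm_num) hD16 : 1 < D)
  have hsqrt : 0 < Real.sqrt D := Real.sqrt_pos.mpr (by positivity)
  have hlog : 0 < Real.log D := Real.log_pos hD1
  have hχ1 : χ ≠ 1 := by
    intro h1
    have hm : χ (-1) = -1 := hodd
    rw [h1, MulChar.one_apply isUnit_one.neg] at hm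
    norm_num at hm
  have hβ1 : β < 1 := lt_one_of_LFunction_eq_zero hχ1 hβ
  -- the zero is in the window of Theorem 1: `1 − β < (log D)⁻² ≤ c₁/log D`
  have hwin : 1 - c₁ / Real.log D < β := by
    have h1 : (Real.log D)⁻¹ < c₁ := by simpa using hN₁ D hD₁.le
    have h2 : 1 / Real.log D ^ 2 ≤ c₁ / Real.log D := by
      rw [div_le_div_iff₀ (by positivity) hlog]
      have : (Real.log D)⁻¹ * Real.log D = 1 := inv_mul_cancel₀ hlog.ne'
      nlinarith
    linarith
  have hE3 : C' * (Real.log (Real.log D) ^ 2 / Real.log D + (Real.log D)⁻¹) ≤ Real.pi * η / 6 :=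
    (hN₃ D hD₃.le).le
  have key := hT D hD₀.le χ hquad hprim β hwin hβ1 hβ
  rw [signedDisc_of_odd hodd] at key
  set M : ℝ := 6 / Real.pi ^ 2 * (χ.LFunction 1).re / formSum (-(D : ℤ)) with hM
  set ℓ : ℝ := Real.log (Real.log D) ^ 2 / Real.log D with hℓ
  have hℓ0 : 0 ≤ ℓ := by positivity
  have hup : 1 - β ≤ M + M * C * (ℓ + (1 - β) * Real.log D) := by
    have := (abs_le.mp key).2
    linarith
  have hMle : M ≤ 6 / Real.pi * (BinaryQuadraticForm.classNumber (-(D : ℤ)) : ℝ) / Real.sqrt D :=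
    mainTerm_le hprim hquad hodd hD16
  have hM0 : 0 ≤ M := by
    have hL0 : 0 ≤ (χ.LFunction 1).re :=
      (LFunction_one_re_pos hprim hquad hodd (lt_trans (by norm_num) hD16)).le
    rw [hM]
    exact div_nonneg (mul_nonneg (by positivity) hL0) (formSum_nonneg _)
  have hprod : (1 - β) * Real.log D ≤ (Real.log D)⁻¹ := by
    have : (1 - β) * Real.log D < 1 / Real.log D ^ 2 * Real.log D :=
      mul_lt_mul_of_pos_right hsmall hlog
    rw [show 1 / Real.log D ^ 2 * Real.log D = (Real.log D)⁻¹ by field_simp] at this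
    exact this.le
  have herr : M * C * (ℓ + (1 - β) * Real.log D) ≤ M * (Real.pi * η / 6) := by
    have hnn : 0 ≤ ℓ + (1 - β) * Real.log D := by
      have : 0 ≤ (1 - β) * Real.log D := mul_nonneg (by linarith) hlog.le
      linarith
    calc M * C * (ℓ + (1 - β) * Real.log D) ≤ M * C' * (ℓ + (1 - β) * Real.log D) := by
          gcongr
      _ = M * (C' * (ℓ + (1 - β) * Real.log D)) := by ring
      _ ≤ M * (C' * (ℓ + (Real.log D)⁻¹)) := by gcongr
      _ ≤ M * (Real.pi * η / 6) := by gcongr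
  have hh0 : (0 : ℝ) ≤ (BinaryQuadraticForm.classNumber (-(D : ℤ)) : ℝ) := Nat.cast_nonneg _
  calc 1 - β ≤ M + M * C * (ℓ + (1 - β) * Real.log D) := hup
    _ ≤ M + M * (Real.pi * η / 6) := by linarith
    _ = M * (1 + Real.pi * η / 6) := by ring
    _ ≤ 6 / Real.pi * (BinaryQuadraticForm.classNumber (-(D : ℤ)) : ℝ) / Real.sqrt D *
          (1 + Real.pi * η / 6) := by gcongr
    _ = (6 / Real.pi + η) * (BinaryQuadraticForm.classNumber (-(D : ℤ)) : ℝ) / Real.sqrt D := by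
        field_simp

/-- **Field-side form of `one_sub_le_classNumber_of_theorem1`: `1 − β ≤ (6/π + η) · h_K/√D`** for
the imaginary quadratic field `K` with `d_K = −D` (`h(−D) = h_K`,
`Quadratic.card_reducedForms_eq_classNumber`), modulo `goldfeldSchinzel1975_theorem1`, for the real
zeros with `1 − β < (log D)⁻²`. [cite: GoldfeldSchinzel1975, Theorem 1 p. 571 with §4 p. 582]
[cite: Cox2013, §7.B Thm. 7.7 (ii)] -/
theorem one_sub_le_classNumber_field_of_theorem1 (h : goldfeldSchinzel1975_theorem1) {η : ℝ}
    (hη : 0 < η) :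
    ∃ c : ℕ, ∀ (D : ℕ) [NeZero D], c < D →
      ∀ χ : DirichletCharacter ℂ D, χ.IsQuadratic → χ.IsPrimitive → χ.Odd →
        ∀ β : ℝ, χ.LFunction (β : ℂ) = 0 → 1 - β < 1 / Real.log D ^ 2 →
          ∀ (K : Type) [Field K] [NumberField K], Module.finrank ℚ K = 2 →
            NumberField.discr K = -(D : ℤ) →
              1 - β ≤ (6 / Real.pi + η) * (NumberField.classNumber K : ℝ) / Real.sqrt D := by
  obtain ⟨c, hc⟩ := one_sub_le_classNumber_of_theorem1 h hη
  refine ⟨c, fun D _ hD χ hquad hprim hodd β hβ hsmall K _ _ h2 hdK => ?_⟩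
  have hd : NumberField.discr K < 0 := by
    have hne : NumberField.discr K ≠ 0 := NumberField.discr_ne_zero K
    rw [hdK] at hne ⊢
    omega
  have hcard := Quadratic.card_reducedForms_eq_classNumber (K := K) h2 hd
  rw [hdK] at hcard
  have := hc D hD χ hquad hprim hodd β hβ hsmall
  rw [hcard] at this
  exact this

end GoldfeldSchinzel1975

end Literature.NumberTheory.LFunctions

end
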